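import Mathlib
import HarnessLib

/-!
# Tree tail bound: the adapted counting step of the excursion-domination line
(crux `SAWLeftRightFKG.FKGToTraversalBound`, stmt-CriticalPhenomena-1878)

Line `excursion-domination` (lead c1), registered sub-goal `stub_treeTailBound` — the adapted form of
Kemppainen–Smirnov's "apply the conditional bound `(n − n₀)/2` times" (Prop. 3.5 of *Random curves,
scaling limits and Loewner evolutions*, 2017), stated DEF-FREE as pure finite combinatorics.

Setting.  Chords `γ ∈ Γ` carry weights `w γ ≥ 0`; `γ` has `L γ` observed crossings, the `i`-th
(`1 ≤ i ≤ L γ`) is costly iff `up γ i = true`; `past γ l` labels the past of `γ` at the `l`-th observation.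
Hypotheses: (adaptedness) chords of `Γ` with the same label at a level `l ≤ L γ` both reach level `l` and
agree on the marks `1..l`; (conditional bound) inside each label class at level `l`, the chords reaching
level `l + 1` with a costly `(l+1)`-st mark weigh at most `p₀ ×` the class; (counting) among the first
`l ≤ L γ` marks of `γ`, `#non-costly ≤ #costly + n₀`.  Conclusion: the chords with `n₀ + 2m ≤ L γ` weigh at
most `(4 p₀)^m 2^{n₀} ×` the total weight.

Proof.
* `sum_filter_positions_le` (ITERATION): for a finite set `S` of positions `≥ 1`, the chords that reach
  every position of `S` with a costly mark there weigh `≤ p₀ ^ #S × Σ_Γ w` — induction on `S` through its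
  maximum `a = l + 1` (`Finset.induction_on_max`): the event "`l ≤ L γ` and costly marks on `S ∖ {a}`" is a
  union of label classes at level `l` (adaptedness), so summing the conditional bound over the classes
  (`Finset.sum_fiberwise_of_maps_to` over the image of `past · l`) costs one factor `p₀`.
* `stub_treeTailBound` (COUNTING): if `n₀ + 2m ≤ L γ` then among the first `n₀ + 2m` marks at least `m` are
  costly, so `γ` lies in one of the `Nat.choose (n₀ + 2m) m ≤ 2 ^ (n₀ + 2m) = 4^m 2^{n₀}` events of the
  iteration lemma with `#S = m`; a union bound finishes.

No named fact is used; axioms are the standard three.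
-/

open Finset

namespace Summit.CriticalPhenomena.SAWScalingLimit.Theorems.FKGToTraversalBound.ExcursionDomination

/-- **Iteration lemma** (the adapted "apply the conditional bound `k` times").  For a finite set `S` of
positions, all `≥ 1`, the chords of `Γ` that reach every position of `S` (`s ≤ L γ`) with a costly mark
there (`up γ s = true`) weigh at most `p₀ ^ #S` times the total weight, given nonnegative weights,
`0 ≤ p₀`, adaptedness of the labels `past` and the conditional bound on each label class. [folklore] -/
theorem sum_filter_positions_le {ι κ : Type} [DecidableEq κ] (Γ : Finset ι) (w : ι → ℝ) (L : ι → ℕ)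
    (up : ι → ℕ → Bool) (past : ι → ℕ → κ) (p₀ : ℝ)
    (hw : ∀ γ, 0 ≤ w γ) (hp : 0 ≤ p₀)
    (hadapt : ∀ γ ∈ Γ, ∀ γ' ∈ Γ, ∀ l : ℕ, l ≤ L γ → past γ l = past γ' l →
      l ≤ L γ' ∧ ∀ i, i ≤ l → up γ i = up γ' i)
    (hcond : ∀ γ₀ ∈ Γ, ∀ l : ℕ, l ≤ L γ₀ →
      ∑ γ ∈ Γ with (past γ l = past γ₀ l ∧ l + 1 ≤ L γ ∧ up γ (l + 1) = true), w γ ≤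
        p₀ * ∑ γ ∈ Γ with past γ l = past γ₀ l, w γ)
    (S : Finset ℕ) (hS : ∀ s ∈ S, 1 ≤ s) :
    ∑ γ ∈ Γ with ((∀ s ∈ S, s ≤ L γ) ∧ ∀ s ∈ S, up γ s = true), w γ ≤
      p₀ ^ #S * ∑ γ ∈ Γ, w γ := by
  induction S using Finset.induction_on_max with
  | empty => simp
  | insert a S haS ih =>
    have ha1 : 1 ≤ a := hS a (mem_insert_self a S)
    have hS1 : ∀ s ∈ S, 1 ≤ s := fun s hs => hS s (mem_insert_of_mem hs)
    have haS' : a ∉ S := fun h => lt_irrefl a (haS a h)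
    obtain ⟨l, rfl⟩ := Nat.exists_eq_add_of_le' ha1
    have hSl : ∀ s ∈ S, s ≤ l := fun s hs => Nat.lt_succ_iff.1 (haS s hs)
    rw [card_insert_of_notMem haS', pow_succ]
    -- the event `E` := "level `l` is reached and the marks on `S` are costly"
    set E : Finset ι := Γ.filter (fun γ => l ≤ L γ ∧ ∀ s ∈ S, up γ s = true) with hE
    -- Step 2: `E` is a union of label classes at level `l`; sum the conditional bound over them
    have h2 : ∑ γ ∈ E with (l + 1 ≤ L γ ∧ up γ (l + 1) = true), w γ ≤ p₀ * ∑ γ ∈ E, w γ := by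
      have hmaps : ∀ γ ∈ E.filter (fun γ => l + 1 ≤ L γ ∧ up γ (l + 1) = true),
          past γ l ∈ E.image (fun γ => past γ l) := fun γ hγ =>
        mem_image_of_mem _ (mem_filter.1 hγ).1
      have hmaps' : ∀ γ ∈ E, past γ l ∈ E.image (fun γ => past γ l) := fun γ hγ =>
        mem_image_of_mem _ hγ
      rw [← sum_fiberwise_of_maps_to hmaps, ← sum_fiberwise_of_maps_to hmaps', mul_sum]
      refine sum_le_sum fun c hc => ?_
      obtain ⟨γ₀, hγ₀E, rfl⟩ := mem_image.1 hc
      have hγ₀ : γ₀ ∈ Γ ∧ l ≤ L γ₀ ∧ ∀ s ∈ S, up γ₀ s = true := by simpa [hE] using hγ₀E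
      calc ∑ γ ∈ E.filter (fun γ => l + 1 ≤ L γ ∧ up γ (l + 1) = true) with past γ l = past γ₀ l, w γ
          ≤ ∑ γ ∈ Γ with (past γ l = past γ₀ l ∧ l + 1 ≤ L γ ∧ up γ (l + 1) = true), w γ := by
            refine sum_le_sum_of_subset_of_nonneg (fun γ hγ => ?_) (fun γ _ _ => hw γ)
            simp only [mem_filter, hE] at hγ ⊢
            exact ⟨hγ.1.1.1, hγ.2, hγ.1.2⟩
        _ ≤ p₀ * ∑ γ ∈ Γ with past γ l = past γ₀ l, w γ := hcond γ₀ hγ₀.1 l hγ₀.2.1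
        _ ≤ p₀ * ∑ γ ∈ E with past γ l = past γ₀ l, w γ := by
            refine mul_le_mul_of_nonneg_left
              (sum_le_sum_of_subset_of_nonneg (fun γ hγ => ?_) (fun γ _ _ => hw γ)) hp
            simp only [mem_filter, hE] at hγ ⊢
            obtain ⟨hlγ, hupγ⟩ := hadapt γ₀ hγ₀.1 γ hγ.1 l hγ₀.2.1 hγ.2.symm
            exact ⟨⟨hγ.1, hlγ, fun s hs => (hupγ s (hSl s hs)).symm.trans (hγ₀.2.2 s hs)⟩, hγ.2⟩
    -- Step 3: `E` is inside the event of the induction hypothesis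
    have h3 : ∑ γ ∈ E, w γ ≤ ∑ γ ∈ Γ with ((∀ s ∈ S, s ≤ L γ) ∧ ∀ s ∈ S, up γ s = true), w γ := by
      refine sum_le_sum_of_subset_of_nonneg (fun γ hγ => ?_) (fun γ _ _ => hw γ)
      simp only [mem_filter, hE] at hγ ⊢
      exact ⟨hγ.1, fun s hs => (hSl s hs).trans hγ.2.1, hγ.2.2⟩
    -- Step 1 (first link): the target event is inside `E ∩ {l + 1 ≤ L, up (l + 1)}`
    calc _ ≤ ∑ γ ∈ E with (l + 1 ≤ L γ ∧ up γ (l + 1) = true), w γ := by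
          refine sum_le_sum_of_subset_of_nonneg (fun γ hγ => ?_) (fun γ _ _ => hw γ)
          simp only [mem_filter, forall_mem_insert, hE] at hγ ⊢
          exact ⟨⟨hγ.1, (Nat.le_succ l).trans hγ.2.1.1, hγ.2.2.2⟩, hγ.2.1.1, hγ.2.2.1⟩
      _ ≤ p₀ * ∑ γ ∈ E, w γ := h2
      _ ≤ p₀ * (p₀ ^ #S * ∑ γ ∈ Γ, w γ) := mul_le_mul_of_nonneg_left (h3.trans (ih hS1)) hp
      _ = p₀ ^ #S * p₀ * ∑ γ ∈ Γ, w γ := by ring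

/-- **Tree tail bound** (registered sub-goal `stub_treeTailBound` of the crux stmt-CriticalPhenomena-1878; the
adapted form of Kemppainen–Smirnov 2017, Prop. 3.5, "apply the conditional bound `(n − n₀)/2` times").
Chords `γ ∈ Γ` with weights `w γ ≥ 0`, `L γ` observed crossings, costly marks `up γ i = true`, past labels
`past γ l`; under adaptedness of the labels, the conditional bound `p₀` on each label class, and the counting
hypothesis `#non-costly ≤ #costly + n₀` among the first `l ≤ L γ` marks, the chords with `n₀ + 2m ≤ L γ` weigh
at most `(4 p₀)^m 2^{n₀}` times the total weight: at least `m` of the first `n₀ + 2m` marks are costly, so the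
event is covered by the `Nat.choose (n₀ + 2m) m ≤ 2^{n₀ + 2m}` events of `sum_filter_positions_le` with `#S = m`,
each of weight `≤ p₀^m Σ_Γ w`. [folklore] -/
theorem stub_treeTailBound :
    ∀ {ι κ : Type} [DecidableEq κ] (Γ : Finset ι) (w : ι → ℝ) (L : ι → ℕ) (up : ι → ℕ → Bool)
      (past : ι → ℕ → κ) (p₀ : ℝ) (n₀ : ℕ),
      (∀ γ, 0 ≤ w γ) → 0 ≤ p₀ →
      (∀ γ ∈ Γ, ∀ γ' ∈ Γ, ∀ l : ℕ, l ≤ L γ → past γ l = past γ' l →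
        l ≤ L γ' ∧ ∀ i, i ≤ l → up γ i = up γ' i) →
      (∀ γ₀ ∈ Γ, ∀ l : ℕ, l ≤ L γ₀ →
        ∑ γ ∈ Γ with (past γ l = past γ₀ l ∧ l + 1 ≤ L γ ∧ up γ (l + 1) = true), w γ ≤
          p₀ * ∑ γ ∈ Γ with past γ l = past γ₀ l, w γ) →
      (∀ γ ∈ Γ, ∀ l : ℕ, l ≤ L γ →
        ((Finset.Icc 1 l).filter (fun i => up γ i = false)).card ≤
          ((Finset.Icc 1 l).filter (fun i => up γ i = true)).card + n₀) →
      ∀ m : ℕ, ∑ γ ∈ Γ with n₀ + 2 * m ≤ L γ, w γ ≤ (4 * p₀) ^ m * 2 ^ n₀ * ∑ γ ∈ Γ, w γ := by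
  intro ι κ _ Γ w L up past p₀ n₀ hw hp hadapt hcond hcount m
  -- the `m`-element sets of positions among the first `n₀ + 2m`
  set 𝒮 : Finset (Finset ℕ) := powersetCard m (Icc 1 (n₀ + 2 * m)) with h𝒮
  -- the event attached to a set of positions
  set A : Finset ℕ → ι → Prop := fun S γ => (∀ s ∈ S, s ≤ L γ) ∧ ∀ s ∈ S, up γ s = true with hA
  have hsum_nonneg : 0 ≤ ∑ γ ∈ Γ, w γ := sum_nonneg fun γ _ => hw γ
  -- each event weighs at most `p₀ ^ m Σ w`
  have key : ∀ S ∈ 𝒮, ∑ γ ∈ Γ with A S γ, w γ ≤ p₀ ^ m * ∑ γ ∈ Γ, w γ := by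
    intro S hS
    rw [h𝒮, mem_powersetCard] at hS
    rw [← hS.2]
    exact sum_filter_positions_le Γ w L up past p₀ hw hp hadapt hcond S
      (fun s hs => (mem_Icc.1 (hS.1 hs)).1)
  -- the events cover `{n₀ + 2m ≤ L}`
  have cover : ∀ γ ∈ Γ, n₀ + 2 * m ≤ L γ → ∃ S ∈ 𝒮, A S γ := by
    intro γ hγ hTL
    have hc := hcount γ hγ (n₀ + 2 * m) hTL
    have hsplit := card_filter_add_card_filter_not (s := Icc 1 (n₀ + 2 * m)) (fun i => up γ i = true)
    simp only [Bool.not_eq_true, Nat.card_Icc, add_tsub_cancel_right] at hsplit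
    have hm : m ≤ #((Icc 1 (n₀ + 2 * m)).filter (fun i => up γ i = true)) := by omega
    obtain ⟨S, hSsub, hScard⟩ := exists_subset_card_eq hm
    refine ⟨S, ?_, fun s hs => ?_, fun s hs => (mem_filter.1 (hSsub hs)).2⟩
    · rw [h𝒮, mem_powersetCard]
      exact ⟨hSsub.trans (filter_subset _ _), hScard⟩
    · exact (mem_Icc.1 (mem_filter.1 (hSsub hs)).1).2.trans hTL
  -- `Nat.choose (n₀ + 2m) m ≤ 2 ^ (n₀ + 2m) = 4 ^ m 2 ^ n₀`
  have hchoose : ((n₀ + 2 * m).choose m : ℝ) ≤ 4 ^ m * 2 ^ n₀ := by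
    have h := Nat.choose_le_two_pow (n₀ + 2 * m) m
    rw [pow_add, pow_mul] at h
    calc ((n₀ + 2 * m).choose m : ℝ) ≤ ((2 ^ n₀ * (2 ^ 2) ^ m : ℕ) : ℝ) := by exact_mod_cast h
      _ = 4 ^ m * 2 ^ n₀ := by push_cast; ring
  calc ∑ γ ∈ Γ with n₀ + 2 * m ≤ L γ, w γ
      ≤ ∑ γ ∈ Γ with n₀ + 2 * m ≤ L γ, ∑ S ∈ 𝒮, (if A S γ then w γ else 0) := by
        refine sum_le_sum fun γ hγ => ?_
        obtain ⟨hγΓ, hTL⟩ := mem_filter.1 hγ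
        obtain ⟨S, hS, hAS⟩ := cover γ hγΓ hTL
        calc w γ = (if A S γ then w γ else 0) := (if_pos hAS).symm
          _ ≤ ∑ S ∈ 𝒮, (if A S γ then w γ else 0) :=
            single_le_sum (f := fun S => if A S γ then w γ else 0)
              (fun S _ => ite_nonneg (hw γ) le_rfl) hS
    _ ≤ ∑ γ ∈ Γ, ∑ S ∈ 𝒮, (if A S γ then w γ else 0) :=
        sum_le_sum_of_subset_of_nonneg (filter_subset _ _)
          (fun γ _ _ => sum_nonneg fun S _ => ite_nonneg (hw γ) le_rfl)
    _ = ∑ S ∈ 𝒮, ∑ γ ∈ Γ, (if A S γ then w γ else 0) := sum_comm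
    _ = ∑ S ∈ 𝒮, ∑ γ ∈ Γ with A S γ, w γ := by simp only [sum_filter]
    _ ≤ ∑ S ∈ 𝒮, p₀ ^ m * ∑ γ ∈ Γ, w γ := sum_le_sum key
    _ = ((n₀ + 2 * m).choose m : ℝ) * (p₀ ^ m * ∑ γ ∈ Γ, w γ) := by
        rw [sum_const, h𝒮, card_powersetCard, Nat.card_Icc, add_tsub_cancel_right, nsmul_eq_mul]
    _ ≤ (4 ^ m * 2 ^ n₀) * (p₀ ^ m * ∑ γ ∈ Γ, w γ) :=
        mul_le_mul_of_nonneg_right hchoose (mul_nonneg (pow_nonneg hp m) hsum_nonneg)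
    _ = (4 * p₀) ^ m * 2 ^ n₀ * ∑ γ ∈ Γ, w γ := by ring

end Summit.CriticalPhenomena.SAWScalingLimit.Theorems.FKGToTraversalBound.ExcursionDomination
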